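import Summits.ResolutionOfSingularities.ResolutionOfSingularities.Theorems.WildConesClassicalRegimesStubMuDropCharTwoOrdPInduction
import Mathlib.Order.WellFounded
import HarnessLib

/-!
# [OURS · L1 W4.2] MODULE `Corridor3WLadderIsoInsepShadowCalculus` (crux chain w42, idea-1 ROUND 7 Sketch C6/C7, cell k2 `T3insep`)
# — k2 PART 1: the characteristic-two SHADOW CALCULUS (§1 split shadow chains, §3a twisted shadow chains), PROVED, fact-free

PROVENANCE / SPLIT FOR THE GATE (typer pass by res-D-pv-042 gen 7; res-L1-w42-plan-1 RULING v3.14-13 (DC) 2026-08-27T10:52:00Z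
«042 := k2 PART 1: ONE fact-free PROVED module `Theorems/…Corridor3WLadderIsoInsepShadowCalculus.lean` = idea-1 C6 sketch §1
`surface_drop_any` + §3a `twist_identity` / `no_twistedChain₂` / `no_shadowChain₂` + 067's `twist_identity_lin`»; second reader
res-type-067 READ 10:41:55Z, memo `HOME/L/res-type-067/READ-C6-067.md`, kernel cert `C6-read-cert-067.lean` sha16 `34f88b22cb8befe6`):
this module lands §1 and §3a of res-L1-w42-idea-1's (gen 7/8) `HOME/L/res-L1-w42-idea-1/Sketch-L1-idea-1-C6.lean` (sha16 `962db48892b2be14`,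
492 l.; farm `lean check` rc 0 · 0 errors · 0 sorries) in the sketch's namespace `…Cruxes.SigmaMaxModifications.IdeasL1C6`, written
against the LANDED W4.1 theorem `WildCones.MuDropCharTwoOrdP.surface_drop_any` (crux `ClassicalRegimes` stmt-…-16884, line
`milnor-descent`, helper Induction) and Mathlib only.  It is PURE COMMUTATIVE ALGEBRA on `κ⟦z,w⟧` — no scheme, no tower, no C5 token is
mentioned (the scheme-side cells k2a/k2b/R1/R2/R3 and their joins over the TREE's C5 tokens `IdeasL1C5.IsInsepStage` /
`IdeasL1C5.IsoInsepTowerTerminates` are k2 PART 2; 067 N1 «no restatement» is honoured there by import).  Differences from the sketch: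
(i) §1 verbatim (carriers `MilnorAlg`, `milnor`, `IsShadowStep₂`, `IsShadowChain₂`; theorems `span_pderiv_sub_eq`, `milnor_lt_of_step`,
`no_shadowChain₂`, `shadowChain₂_length_le`), except that `span_pderiv_sub_eq` uses the section binders instead of `omit … in` + re-binding
(statement byte-identical); (ii) §3a: res-type-067's FREE GENERALISATION N5 is adopted — `twist_identity_lin` (arbitrary absorbed form `ℓ`,
verbatim from the cert) is the primary identity, the sketch's `twist_identity` (`ℓ = C r * X i`) its instance, and the structure
`IsTwistedChain₂.step` is typed with `∃ ℓ` (feedback `X i ^ 2 * ℓ * a (n+1)`, coherence `X i * (σ (n+1) + ℓ) = σ n ∘ Φ`) instead of the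
hard-coded `C r * X i ^ 3 * a (n+1)`; the sketch's form is recovered by `IsTwistedChain₂.of_chartSquare`; (iii) the finite form
`twistedChain₂_length_le` (d-46 style bound `L ≤ μ(G₀)`) is added; (iv) the extraction rows `SplitShadowExtraction₂` / `RidgeTwistExtraction₂`,
the support row `InsepStageIsRidge` and the §3c layer calculus are NOT typed (067 N2/N3/N4/S1: held for idea-1's step-local re-cut).
All statements are OURS carriers / OURS theorems; cited works are POINTERS; NOT statements of [CossartPiltant2009], [CossartJannsenSaito2020]
nor of the manuscript [Hironaka2017] under review in the cell; helper vocabulary + proved algebra, `--supports stmt-…-19249`, counted 0.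
AI typing, weaker than expert review.  idea-1's module docstring (§1/§3 parts) follows, abridged to what this module contains.
-/

/-!
# [OURS · L1 W4.2 · idea-1 round 7 · cards C6/C7] the k2 cut of `T3insep` — ALGEBRAIC SHADOWS at `p = 2`

[OURS · L1 W4.2] — replaces the role of no printed item; NOT a statement of Hironaka 2017, of CJS 2020
(`paper:url-3343fd9e678b` / LNM 2270) nor of Cossart–Piltant. AI-typed, weaker than expert review.

Context (CHAIN v3.12 NOT-DEALT, RULINGS v3.12-1 (F) rider (c)): the isolated kernel of the W-top rows is
`IsoQuadraticTowerTerminates p 3` (p500943, `…IdeasL1Idea2R4`), covered three ways: (k1) separable vertex towers (C4,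
D2/D4/D5), (k2) INSEPARABLE-directrix-recurrent towers `T3insep` = `IdeasL1C5.IsoInsepTowerTerminates p 3`, (k3) translation towers.

* §1 (ALGEBRA, PROVED, fact-free): `no_shadowChain₂` — in characteristic two there is NO infinite chain
  `g₀, g₁, … ∈ κ⟦z,w⟧` of states of order `≥ 2` without `zw`-term, all with FINITE Milnor algebra `κ⟦z,w⟧/(∂_z g, ∂_w g)`,
  each obtained from the previous one by a point blow-up chart with translation, division by the square of the exceptional
  variable, and addition of `d`-closed junk (absorbed squares and constants). One line from
  `WildCones.MuDropCharTwoOrdP.surface_drop_any` (Max Noether's inequality + multiplicity `≤ 3` of the exceptional line in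
  `(∂G)`, W4.1 helper Induction) and well-foundedness of `ℕ`. This is tri-1's requested `mu_strictAnti_of_isNearPoint (p = 2)`
  (TRIAGE v5.3 R6-C5 (ii)) — it need not be proved again: it is `surface_drop_any`.
* §3a (card C7, k2b at `p = 2`): the TWIST IDENTITY (PROVED ring identity: the blow-up FEEDBACK of an absorbed form into the
  shadow, `g' = T(g) + ℓ·a' + s`, is linear in a re-adaptation `x ↦ x + σ`, and along a COHERENT `σ` (`X_i(σ' + ℓ) = σ∘Φ`) the
  twisted shadows `G = g + aσ` obey the SPLIT law of §1), `IsTwistedChain₂` and the PROVED `no_twistedChain₂`.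

Nothing here asserts anything about towers of blow-ups. `lean check` (farm, build_tag res): rc 0, 0 sorries.
-/

noncomputable section

-- cell module setting (namespace `Summit.ResolutionOfSingularities.ResolutionOfSingularities.…` re-enters the summit name)
set_option linter.dupNamespace false

open scoped BigOperators Classical
open MvPowerSeries
open Literature.AlgebraicGeometry.Resolution
open Summit.ResolutionOfSingularities.ResolutionOfSingularities.Theorems.WildCones.MuDropCharTwoOrdP
  (surface_drop_any hasSubst_blowFam)

namespace Summit.ResolutionOfSingularities.ResolutionOfSingularities.Cruxes.SigmaMaxModifications.IdeasL1C6

/-! ## §1. The characteristic-two surface-shadow chain (ALGEBRA; PROVED from W4.1) -/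

section Algebra

variable {κ : Type} [Field κ]

/-- [OURS · C6 §1 · carrier] The Milnor algebra `κ⟦z,w⟧/(∂_z g, ∂_w g)` of a state (W4.1's carrier, verbatim). -/
abbrev MilnorAlg (g : MvPowerSeries (Fin 2) κ) : Type :=
  MvPowerSeries (Fin 2) κ ⧸ Ideal.span (Set.range fun s => MvPowerSeries.pderiv s g)

/-- [OURS · C6 §1 · carrier] `μ(g) := dim_κ κ⟦z,w⟧/(∂g)` (meaningful when the Milnor algebra is finite = the point is
isolated in the stratum). -/
def milnor (g : MvPowerSeries (Fin 2) κ) : ℕ := Module.finrank κ (MilnorAlg g)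

/-- [OURS · C6 §1] **SHADOW STEP** at `p = 2`: `b` is, up to `d`-CLOSED junk `s` (`∂_z s = ∂_w s = 0`: absorbed squares
`αz² + βw²`, constants, any element of `κ⟦z²,w²⟧`), the strict transform of `a` in the blow-up chart of the exceptional variable
`X i` with translation `τ` (W4.1's family `Φ_{i,τ} : X_i ↦ X_i, X_s ↦ X_i (X_s + τ_s)`): `X_i² · (b − s) = a ∘ Φ_{i,τ}`.
(The strict transform of a plane series in a point-blow-up chart; OURS carrier, no published source claimed.) [folklore] -/
def IsShadowStep₂ (a b : MvPowerSeries (Fin 2) κ) : Prop :=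
  ∃ (i : Fin 2) (τ : Fin 2 → κ) (s : MvPowerSeries (Fin 2) κ), (∀ t, MvPowerSeries.pderiv t s = 0) ∧
    X i ^ 2 * (b - s) = subst (fun t => if t = i then (X i : MvPowerSeries (Fin 2) κ) else X i * (X t + C (τ t))) a

/-- [OURS · C6 §1] an (infinite) **SHADOW CHAIN** at `p = 2`: states of order `≥ 2` without `zw`-term (the `zw`-term is the
`(e,ē) = (0,1)` exit of the threefold: `in = x² + λy² + zw`), every Milnor algebra finite (⟸ isolation + a SEPARABLE step into the
stage, card C6 (L-crit)/(L-exact); finiteness is SUFFICIENT for isolation, not equivalent), consecutive states related by a shadow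
step. (OURS bookkeeping carrier; no published source claimed.) [folklore] -/
structure IsShadowChain₂ (g : ℕ → MvPowerSeries (Fin 2) κ) : Prop where
  /-- every state has order at least two -/
  two_le : ∀ n, 2 ≤ (g n).order
  /-- no state has a `zw`-term -/
  nopair : ∀ n, coeff (Finsupp.single 0 1 + Finsupp.single 1 1) (g n) = 0
  /-- every Milnor algebra is finite over `κ` -/
  finite : ∀ n, Module.Finite κ (MilnorAlg (g n))
  /-- consecutive states are related by a shadow step -/
  step : ∀ n, IsShadowStep₂ (g n) (g (n + 1))

/-- [OURS · C6 §1 · PROVED] `d`-closed junk does not change the Milnor ideal. -/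
theorem span_pderiv_sub_eq {b s : MvPowerSeries (Fin 2) κ} (hs : ∀ t, MvPowerSeries.pderiv t s = 0) :
    Ideal.span (Set.range fun t => MvPowerSeries.pderiv t (b - s)) =
      Ideal.span (Set.range fun t => MvPowerSeries.pderiv t b) := by
  have : (fun t => MvPowerSeries.pderiv t (b - s)) = fun t => MvPowerSeries.pderiv t b := by
    funext t
    rw [map_sub, hs t, sub_zero]
  rw [this]

/-- [OURS · C6 §1 · PROVED from W4.1] **μ STRICTLY DROPS AT EVERY ISOLATED SHADOW STEP** (char 2): this is
`WildCones.MuDropCharTwoOrdP.surface_drop_any` transported along the junk. (= tri-1's `mu_strictAnti_of_isNearPoint (p = 2)`.) -/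
theorem milnor_lt_of_step [CharP κ 2] {a b : MvPowerSeries (Fin 2) κ} (ha : 2 ≤ a.order)
    (hnopair : coeff (Finsupp.single 0 1 + Finsupp.single 1 1) a = 0) (hstep : IsShadowStep₂ a b)
    (hfa : Module.Finite κ (MilnorAlg a)) (hfb : Module.Finite κ (MilnorAlg b)) :
    milnor b < milnor a := by
  obtain ⟨i, τ, s, hs, h⟩ := hstep
  have key := span_pderiv_sub_eq (b := b) hs
  haveI hfG : Module.Finite κ (MvPowerSeries (Fin 2) κ ⧸
      Ideal.span (Set.range fun t => MvPowerSeries.pderiv t (b - s))) := by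
    rw [key]; exact hfb
  have := surface_drop_any i τ ha hnopair h hfa hfG
  rw [key] at this
  exact this

/-- [OURS · C6 §1 · PROVED] **NO INFINITE SHADOW CHAIN IN CHARACTERISTIC TWO.** The algebraic shadow of «k2a at p = 2»:
`μ(g_n)` is a strictly decreasing sequence of natural numbers. -/
theorem no_shadowChain₂ [CharP κ 2] (g : ℕ → MvPowerSeries (Fin 2) κ) (h : IsShadowChain₂ g) : False := by
  have hlt : ∀ n, milnor (g (n + 1)) < milnor (g n) := fun n =>
    milnor_lt_of_step (h.two_le n) (h.nopair n) (h.step n) (h.finite n) (h.finite (n + 1))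
  have hle : ∀ n, milnor (g n) + n ≤ milnor (g 0) := by
    intro n
    induction n with
    | zero => simp
    | succ n ih => have := hlt n; omega
  have := hle (milnor (g 0) + 1)
  omega

/-- [OURS · C6 §1 · PROVED] finite form: a shadow chain of length `L` (states `g 0, …, g L`) has `L ≤ μ(g 0)`. -/
theorem shadowChain₂_length_le [CharP κ 2] (L : ℕ) (g : ℕ → MvPowerSeries (Fin 2) κ)
    (two_le : ∀ n, n ≤ L → 2 ≤ (g n).order)
    (nopair : ∀ n, n ≤ L → coeff (Finsupp.single 0 1 + Finsupp.single 1 1) (g n) = 0)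
    (finite : ∀ n, n ≤ L → Module.Finite κ (MilnorAlg (g n)))
    (step : ∀ n, n < L → IsShadowStep₂ (g n) (g (n + 1))) : L ≤ milnor (g 0) := by
  have hle : ∀ n, n ≤ L → milnor (g n) + n ≤ milnor (g 0) := by
    intro n
    induction n with
    | zero => intro; simp
    | succ n ih =>
      intro hn
      have h1 := ih (by omega)
      have h2 := milnor_lt_of_step (two_le n (by omega)) (nopair n (by omega)) (step n (by omega))
        (finite n (by omega)) (finite (n + 1) hn)
      omega
  have := hle L le_rfl
  omega

end Algebra

/-! ## §3a. Card C7 — k2b at `p = 2`: the TWISTED SHADOW (PROVED reduction to §1)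

The k2b tail keeps the ridge `x² + λy²` but carries LAYERS `x·a + y·b + xy·c` (`a, b, c ∈ κ⟦z,w⟧`) and the blow-up FEEDS an
absorbed form back (`x ↦ x + ℓ` injects `ℓ·a'` into the shadow; `ℓ = √H·X_i` for the chart variable's square, `√C·u` for the
other exceptional-plane variable, any linear `αz + βu`, …). KEY IDENTITY (char 2): the feedback is LINEAR in a re-adaptation
`x ↦ x + σ(z,w)`, and along a COHERENT sequence of re-adaptations `X_i(σ_{n+1} + ℓ_n) = σ_n∘Φ` the twisted shadows
`G_n := g_n + a_n σ_n` form a §1 shadow chain EXACTLY (`X_i²(G_{n+1} − s_n) = G_n ∘ Φ`). So §1's theorem (W4.1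
`surface_drop_any`) governs k2b too, CONDITIONAL on the finiteness of the twisted Milnor algebras. -/

section Twist

variable {κ : Type} [Field κ]

/-- [OURS · C7 §3a · substitution datum] W4.1's blow-up chart family `Φ_{i,τ}` on `κ⟦z,w⟧` (reducible abbreviation of the
inlined lambda of §1 and of `WildCones.MuDropCharTwoOrdP.surface_drop_any`). -/
abbrev bl (i : Fin 2) (τ : Fin 2 → κ) : Fin 2 → MvPowerSeries (Fin 2) κ :=
  fun t => if t = i then (X i : MvPowerSeries (Fin 2) κ) else X i * (X t + C (τ t))

/-- [OURS · C7 §3a · PROVED; res-type-067 N5, free generalisation] the **TWIST IDENTITY** for an ARBITRARY absorbed form `ℓ`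
(pure ring identity). k2b step law at `p = 2` in the chart of `X i`: shadow `X_i²(g' − s) = g∘Φ + X_i²·ℓ·a'` (`ℓ` the fed-back
absorbed form; `s` the `d`-closed junk), layer `X_i·a' = a∘Φ` (weight 1, NO feedback into `a`), coherent re-adaptation
`X_i(σ' + ℓ) = σ∘Φ`. THEN the twisted shadows `G = g + aσ`, `G' = g' + a'σ'` satisfy the SPLIT step law `X_i²(G' − s) = G∘Φ`
of §1. (Absorbing the square of the OTHER chart variable, `x ↦ x + βu`, or any linear `αz + βu` feeds `ℓ·a'` back; the identity
holds verbatim.) -/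
theorem twist_identity_lin {i : Fin 2} {τ : Fin 2 → κ} {ℓ g g' a a' σ σ' s : MvPowerSeries (Fin 2) κ}
    (hg : X i ^ 2 * (g' - s) = subst (bl i τ) g + X i ^ 2 * ℓ * a')
    (ha : X i * a' = subst (bl i τ) a)
    (hσ : X i * (σ' + ℓ) = subst (bl i τ) σ) :
    X i ^ 2 * (g' + a' * σ' - s) = subst (bl i τ) (g + a * σ) := by
  have hΦ : HasSubst (bl i τ) := hasSubst_blowFam i τ
  rw [subst_add hΦ, subst_mul hΦ, ← ha, ← hσ]
  have hg' : subst (bl i τ) g = X i ^ 2 * (g' - s) - X i ^ 2 * ℓ * a' := by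
    rw [eq_sub_iff_add_eq]; exact hg.symm
  rw [hg']; ring

/-- [OURS · C7 §3a · PROVED] the **TWIST IDENTITY** of the sketch: the instance `ℓ = r·X_i` of `twist_identity_lin`
(`r = √H`, the fed-back absorbed square of the chart variable: shadow `X_i²(g' − s) = g∘Φ + r·X_i³·a'`, coherence
`X_i(σ' + r X_i) = σ∘Φ`). -/
theorem twist_identity {i : Fin 2} {τ : Fin 2 → κ} {r : κ} {g g' a a' σ σ' s : MvPowerSeries (Fin 2) κ}
    (hg : X i ^ 2 * (g' - s) = subst (bl i τ) g + C r * X i ^ 3 * a')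
    (ha : X i * a' = subst (bl i τ) a)
    (hσ : X i * (σ' + C r * X i) = subst (bl i τ) σ) :
    X i ^ 2 * (g' + a' * σ' - s) = subst (bl i τ) (g + a * σ) :=
  twist_identity_lin (ℓ := C r * X i) (by rw [hg]; ring) ha hσ

/-- [OURS · C7 §3a] a **TWISTED k2b CHAIN** at `p = 2`: shadows `g_n`, `x`-layers `a_n`, coherent re-adaptations `σ_n`, each
step an instance of the three laws of `twist_identity_lin` for SOME absorbed form `ℓ` (res-type-067 N5: not only `ℓ = r·X_i`) and
some `d`-closed junk `s`, and the TWISTED shadows `G_n = g_n + a_n σ_n` of order `≥ 2`, without `zw`-term, with FINITE Milnor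
algebras (the conjectural finiteness clause `K2B-fin` of card C7 is an INPUT here, not a claim). (OURS bookkeeping carrier; no
published source claimed.) [folklore] -/
structure IsTwistedChain₂ (g a σ : ℕ → MvPowerSeries (Fin 2) κ) : Prop where
  /-- the three step laws (shadow with feedback `ℓ`, layer of weight one, coherent re-adaptation) in some chart `Φ_{i,τ}` -/
  step : ∀ n, ∃ (i : Fin 2) (τ : Fin 2 → κ) (ℓ s : MvPowerSeries (Fin 2) κ), (∀ t, MvPowerSeries.pderiv t s = 0) ∧
    X i ^ 2 * (g (n + 1) - s) = subst (bl i τ) (g n) + X i ^ 2 * ℓ * a (n + 1) ∧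
    X i * a (n + 1) = subst (bl i τ) (a n) ∧ X i * (σ (n + 1) + ℓ) = subst (bl i τ) (σ n)
  /-- every twisted shadow has order at least two -/
  two_le : ∀ n, 2 ≤ (g n + a n * σ n).order
  /-- no twisted shadow has a `zw`-term -/
  nopair : ∀ n, coeff (Finsupp.single 0 1 + Finsupp.single 1 1) (g n + a n * σ n) = 0
  /-- every twisted Milnor algebra is finite over `κ` -/
  finite : ∀ n, Module.Finite κ (MilnorAlg (g n + a n * σ n))

/-- [OURS · C7 §3a · PROVED] the sketch's typing of a twisted chain (feedback hard-coded as the chart variable's square,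
`C (r n) * X i ^ 3 * a (n+1)`, coherence `X i * (σ (n+1) + C (r n) * X i)`) IS a twisted chain in the sense above
(`ℓ_n = r_n·X_{i_n}`). -/
theorem IsTwistedChain₂.of_chartSquare {g a σ : ℕ → MvPowerSeries (Fin 2) κ}
    (step : ∀ n, ∃ (i : Fin 2) (τ : Fin 2 → κ) (r : κ) (s : MvPowerSeries (Fin 2) κ),
      (∀ t, MvPowerSeries.pderiv t s = 0) ∧
      X i ^ 2 * (g (n + 1) - s) = subst (bl i τ) (g n) + C r * X i ^ 3 * a (n + 1) ∧
      X i * a (n + 1) = subst (bl i τ) (a n) ∧ X i * (σ (n + 1) + C r * X i) = subst (bl i τ) (σ n))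
    (two_le : ∀ n, 2 ≤ (g n + a n * σ n).order)
    (nopair : ∀ n, coeff (Finsupp.single 0 1 + Finsupp.single 1 1) (g n + a n * σ n) = 0)
    (finite : ∀ n, Module.Finite κ (MilnorAlg (g n + a n * σ n))) : IsTwistedChain₂ g a σ where
  step n := by
    obtain ⟨i, τ, r, s, hs, hg, ha, hσ⟩ := step n
    exact ⟨i, τ, C r * X i, s, hs, by rw [hg]; ring, ha, hσ⟩
  two_le := two_le
  nopair := nopair
  finite := finite

/-- [OURS · C7 §3a · PROVED] a twisted k2b chain IS a §1 shadow chain of its twisted shadows. -/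
theorem IsTwistedChain₂.shadow {g a σ : ℕ → MvPowerSeries (Fin 2) κ} (h : IsTwistedChain₂ g a σ) :
    IsShadowChain₂ (fun n => g n + a n * σ n) where
  two_le := h.two_le
  nopair := h.nopair
  finite := h.finite
  step n := by
    obtain ⟨i, τ, ℓ, s, hs, hg, ha, hσ⟩ := h.step n
    exact ⟨i, τ, s, hs, twist_identity_lin hg ha hσ⟩

/-- [OURS · C7 §3a · PROVED from W4.1] **NO INFINITE TWISTED k2b CHAIN** in characteristic 2. -/
theorem no_twistedChain₂ [CharP κ 2] (g a σ : ℕ → MvPowerSeries (Fin 2) κ) (h : IsTwistedChain₂ g a σ) : False :=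
  no_shadowChain₂ _ h.shadow

/-- [OURS · C7 §3a · PROVED] finite form: `L` consecutive twisted steps (the three laws of `twist_identity_lin` at each
`n < L`) whose twisted shadows `G_n = g_n + a_n σ_n`, `n ≤ L`, have order `≥ 2`, no `zw`-term and finite Milnor algebras,
satisfy `L ≤ μ(G_0)`. -/
theorem twistedChain₂_length_le [CharP κ 2] (L : ℕ) (g a σ : ℕ → MvPowerSeries (Fin 2) κ)
    (two_le : ∀ n, n ≤ L → 2 ≤ (g n + a n * σ n).order)
    (nopair : ∀ n, n ≤ L → coeff (Finsupp.single 0 1 + Finsupp.single 1 1) (g n + a n * σ n) = 0)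
    (finite : ∀ n, n ≤ L → Module.Finite κ (MilnorAlg (g n + a n * σ n)))
    (step : ∀ n, n < L → ∃ (i : Fin 2) (τ : Fin 2 → κ) (ℓ s : MvPowerSeries (Fin 2) κ),
      (∀ t, MvPowerSeries.pderiv t s = 0) ∧
      X i ^ 2 * (g (n + 1) - s) = subst (bl i τ) (g n) + X i ^ 2 * ℓ * a (n + 1) ∧
      X i * a (n + 1) = subst (bl i τ) (a n) ∧ X i * (σ (n + 1) + ℓ) = subst (bl i τ) (σ n)) :
    L ≤ milnor (g 0 + a 0 * σ 0) := by
  refine shadowChain₂_length_le L (fun n => g n + a n * σ n) two_le nopair finite fun n hn => ?_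
  obtain ⟨i, τ, ℓ, s, hs, hg, ha, hσ⟩ := step n hn
  exact ⟨i, τ, s, hs, twist_identity_lin hg ha hσ⟩

end Twist

end Summit.ResolutionOfSingularities.ResolutionOfSingularities.Cruxes.SigmaMaxModifications.IdeasL1C6

end
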